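import Summits.BirchSwinnertonDyer.BirchSwinnertonDyer.Theorems.ByReductionTypeAtTwoRankOneAtTwoBigImageOddLocalFklTopLevel
import HarnessLib

/-!
# Line `fkl` of crux `RankOneAtTwoBigImageOddLocal` (stmt-BirchSwinnertonDyer-23715, route ByReductionTypeAtTwo):
# the LEVEL-SHIFT congruence `δ'_{j+1}(ℓ; ψ) ≡ δ'_j(ℓ; ψ mod 2^j) (mod 2^{j+1})` at every `τ`-row, and level two = `T_ℓ mod 4`

Lead prover seat `bsd-line-fkl-p1` (g2), helpers `--supports stmt-BirchSwinnertonDyer-23715` (v7 stubs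
`stub_firstLayerHigherCongruence` / `stub_firstLayerNonVanishing` and their analytic twins); sequel to `…FklTopLevel` (p597859).

**Level shift.**  Let `f` be the newform of a globally minimal `W/ℚ` of POSITIVE analytic rank, `ℓ ∤ 2N_W` a prime,
`ψ : (ℤ/ℓ)ˣ → ℤ/2^{j+1}` a homomorphism and `ψ' = ψ mod 2^j`.
* NON-TOP rows (`2^{j+2} ∣ ℓ − 1`): `ψ(−1) = 1` (`apply_neg_one_eq_one_of_dvd`: `−1 = g^{(ℓ−1)/2}` is a `2^{j+1}`-th power), so the
  top bit `b(u) = ⌊ψ̃(u)/2^j⌋` is INVARIANT under `u ↦ −u`; with `2[u/ℓ]⁺_f = k_u ∈ ℤ` (positive rank) and `k_{−u} = k_u` the sum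
  `∑ k_u b(u)` is even (fixed-point-free involution), whence `δ'_{j+1}(ψ) − δ'_j(ψ') = 2^j ∑ k_u b(u) ∈ 2^{j+1} ℤ_{(2)}`
  (`levelSumTwo_succ_sub_inTwoPowZLoc`).
* TOP rows (`2^{j+1} ∥ ℓ − 1`, `ψ` onto): `δ'_{j+1}(ψ) = δ'_j(ψ')` exactly (`…FklTopLevel.levelSumTwo_succ_eq_of_analyticRank_ne_zero`).
Hence at EVERY row with `2^{j+1} ∣ ℓ − 1` and EVERY `m ≤ j + 1`:  `δ'_{j+1}(ψ) ∈ 2^m ℤ_{(2)} ⟺ δ'_j(ψ') ∈ 2^m ℤ_{(2)}`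
(`inTwoPowZLoc_levelSumTwo_succ_iff`): the level-`(j+1)` row of K2-F carries exactly «one more bit of the level-`j` number».
**Level two is `T_ℓ mod 4`** (`inTwoPowZLoc_two_levelSumTwo_two_iff`): for every `τ`-prime with `4 ∣ ℓ − 1` and every `ψ` onto `ℤ/4`,
`4 ∣ δ'_2(ℓ;ψ) ⟺ 4 ∣ T_ℓ(f)` (`T_ℓ(f) = ∑_a (a/ℓ)[a/ℓ]⁺_f = L(E^{(ℓ)},1)/Ω(E^{(ℓ)})`).  So, for the v7 stubs:
(HC) at level `2` says «`Ш(E)[2] ≠ 0 ⇒ 4 ∣ T_ℓ(f)` for every `τ`-prime `ℓ ≡ 1 (4)` with `4 ∣ a_ℓ − 2`»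
(`firstLayerHigherCongruence_levelTwo_iff`), and (NV) for parameter `0` is witnessed by ANY `τ`-prime `ℓ ≡ 1 (4)` with
`4 ∣ a_ℓ − 2` and `T_ℓ(f) ≡ 2 (mod 4)` (`firstLayerNonVanishing_zero_of_twist'`), generalising the `ℓ ≡ 5 (8)` case of `…FklTopLevel`.
Theorems only; no `def`, no named-fact hypothesis, no `sorry`.  BSD is not proved by any of this.
-/

set_option autoImplicit false

noncomputable section

open scoped Classical MatrixGroups ModularForm

set_option linter.dupNamespace false

namespace Summit.BirchSwinnertonDyer.BirchSwinnertonDyer.Theorems.RankOneAtTwoFkl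

open CongruenceSubgroup WeierstrassCurve Literature.NumberTheory.EllipticCurves
  Literature.NumberTheory.EllipticCurves.ModularForms Summit.BirchSwinnertonDyer.Rank1Residual.F1Sign2

/-! ## `2^k ℤ_{(2)}` is a group -/

/-- `2^k ℤ_{(2)}` is closed under addition. [folklore] -/
theorem inTwoPowZLoc_add {k : ℕ} {x y : ℚ} (hx : InTwoPowZLoc k x) (hy : InTwoPowZLoc k y) :
    InTwoPowZLoc k (x + y) := by
  obtain ⟨q₁, hq₁, hd₁⟩ := hx
  obtain ⟨q₂, hq₂, hd₂⟩ := hy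
  exact ⟨q₁ + q₂, by rw [hq₁, hq₂]; ring, odd_den_add hd₁ hd₂⟩

/-- `2^k ℤ_{(2)}` is closed under subtraction. [folklore] -/
theorem inTwoPowZLoc_sub {k : ℕ} {x y : ℚ} (hx : InTwoPowZLoc k x) (hy : InTwoPowZLoc k y) :
    InTwoPowZLoc k (x - y) := by
  rw [sub_eq_add_neg]
  exact inTwoPowZLoc_add hx ((inTwoPowZLoc_neg_iff k y).mpr hy)

/-- Membership in `2^k ℤ_{(2)}` only depends on the class modulo `2^k ℤ_{(2)}`. [folklore] -/
theorem inTwoPowZLoc_iff_of_sub {k m : ℕ} (hmk : m ≤ k) {x y : ℚ} (h : InTwoPowZLoc k (x - y)) :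
    InTwoPowZLoc m x ↔ InTwoPowZLoc m y := by
  have h' : InTwoPowZLoc m (x - y) := inTwoPowZLoc_mono hmk h
  constructor
  · intro hx
    have := inTwoPowZLoc_sub hx h'
    rwa [sub_sub_cancel] at this
  · intro hy
    have := inTwoPowZLoc_add h' hy
    rwa [sub_add_cancel] at this

/-! ## Non-top rows: `ψ(−1) = 1` -/

/-- **At a non-top level `ψ(−1)` is trivial:** if `2^{j+2} ∣ ℓ − 1` then every homomorphism `ψ : (ℤ/ℓ)ˣ → ℤ/2^{j+1}` kills
`−1` (`−1 = g^{(ℓ−1)/2}` for a generator `g`, and `2^{j+1} ∣ (ℓ−1)/2`). [folklore] -/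
theorem apply_neg_one_eq_one_of_dvd {ℓ : ℕ} [Fact ℓ.Prime] {j : ℕ} (h : 2 ^ (j + 2) ∣ ℓ - 1)
    (ψ : (ZMod ℓ)ˣ →* Multiplicative (ZMod (2 ^ (j + 1)))) : ψ (-1) = 1 := by
  haveI : NeZero (2 ^ (j + 1)) := ⟨by positivity⟩
  obtain ⟨g, hg⟩ := IsCyclic.exists_generator (α := (ZMod ℓ)ˣ)
  have hgen : ∀ x : (ZMod ℓ)ˣ, ∃ n : ℕ, g ^ n = x := fun x =>
    (Submonoid.mem_powers_iff _ _).mp (mem_powers_iff_mem_zpowers.mpr (hg x))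
  have horder : orderOf g = ℓ - 1 := by
    rw [orderOf_eq_card_of_forall_mem_zpowers hg, Nat.card_eq_fintype_card, ZMod.card_units]
  obtain ⟨n, hn⟩ := hgen (-1)
  have h2n : g ^ (2 * n) = 1 := by rw [mul_comm, pow_mul, hn, neg_one_sq]
  have hdvd : ℓ - 1 ∣ 2 * n := horder ▸ orderOf_dvd_of_pow_eq_one h2n
  have hn' : 2 ^ (j + 1) ∣ n := by
    have h2 : 2 * 2 ^ (j + 1) ∣ 2 * n := by
      rw [← pow_succ']
      exact dvd_trans h hdvd
    exact Nat.dvd_of_mul_dvd_mul_left two_pos h2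
  have hcard : orderOf (ψ g) ∣ n :=
    dvd_trans (orderOf_dvd_card (x := ψ g)) (by rw [Fintype.card_multiplicative, ZMod.card]; exact hn')
  rw [← hn, map_pow]
  exact orderOf_dvd_iff_pow_eq_one.mp hcard

/-! ## The level-shift congruence -/

/-- **LEVEL SHIFT at non-top rows.**  For the newform `f` of a globally minimal `W/ℚ` of positive analytic rank, an odd prime
`ℓ ∤ N_W` with `2^{j+2} ∣ ℓ − 1`, ANY homomorphism `ψ : (ℤ/ℓ)ˣ → ℤ/2^{j+1}` and its reduction `ψ' = ψ mod 2^j`: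
`δ'_{j+1}(ℓ; ψ) − δ'_j(ℓ; ψ') ∈ 2^{j+1} ℤ_{(2)}`.  (The difference is `2^j ∑_u 2[u/ℓ]⁺ b(u)` with `b = ⌊ψ̃/2^j⌋` even under
`u ↦ −u`; `2[u/ℓ]⁺ ∈ ℤ` in positive rank.) [folklore] -/
theorem levelSumTwo_succ_sub_inTwoPowZLoc (W : WeierstrassCurve ℚ) [W.IsElliptic] [W.IsGloballyMinimal]
    {M : ℕ} [NeZero M] (f : CuspForm (Gamma0 M) 2) (hf : IsNewformOf W f) (hr : W.analyticRank ≠ 0)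
    {ℓ : ℕ} [Fact ℓ.Prime] (hℓ2 : ℓ ≠ 2) (hN : ¬ ℓ ∣ W.conductorNorm ℤ) {j : ℕ} (h : 2 ^ (j + 2) ∣ ℓ - 1)
    (ψ : (ZMod ℓ)ˣ →* Multiplicative (ZMod (2 ^ (j + 1))))
    (ψ' : (ZMod ℓ)ˣ →* Multiplicative (ZMod (2 ^ j)))
    (hψ' : ∀ u, (Multiplicative.toAdd (ψ' u)).val = (Multiplicative.toAdd (ψ u)).val % 2 ^ j) :
    InTwoPowZLoc (j + 1) (levelSumTwo f ℓ (j + 1) ψ - levelSumTwo f ℓ j ψ') := by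
  have hℓ : ℓ.Prime := Fact.out
  haveI : NeZero ℓ := ⟨hℓ.ne_zero⟩
  haveI : NeZero (2 ^ (j + 1)) := ⟨by positivity⟩
  have hℓM : ¬ ℓ ∣ M := fun h => hN ((hf.dvd_level_iff_dvd_conductorNorm hℓ).mp h)
  have hcop : Nat.Coprime ℓ M := (Nat.Prime.coprime_iff_not_dvd hℓ).mpr hℓM
  -- integer values `kk u = 2[u/ℓ]⁺`
  have hden : ∀ u : (ZMod ℓ)ˣ, Nat.Coprime ((((u : ZMod ℓ).val : ℚ)) / ℓ).den M := fun u => by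
    have h := coprime_den_of_coprime (N := M) hcop ((u : ZMod ℓ).val : ℤ)
    rwa [Int.cast_natCast] at h
  choose kk hkk using fun u : (ZMod ℓ)ˣ =>
    exists_ratPlusSymbol_eq_int_div_two W f hf hr (hden u)
  have hkneg : ∀ u : (ZMod ℓ)ˣ, kk (-u) = kk u := fun u => by
    have h := ratPlusSymbol_neg_unit f u
    rw [hkk (-u), hkk u] at h
    exact_mod_cast (by linarith : (kk (-u) : ℚ) = kk u)
  -- the lift `a u = ψ̃(u)` is even under `u ↦ -u` (non-top row)
  set a : (ZMod ℓ)ˣ → ℕ := fun u => (Multiplicative.toAdd (ψ u)).val with ha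
  have ha_neg : ∀ u, a (-u) = a u := by
    intro u
    show (Multiplicative.toAdd (ψ (-u))).val = (Multiplicative.toAdd (ψ u)).val
    rw [← neg_one_mul u, map_mul, apply_neg_one_eq_one_of_dvd h ψ, one_mul]
  -- integer weight `g u = kk u · ⌊a u / 2^j⌋`, even sum
  let g : (ZMod ℓ)ˣ → ℤ := fun u => kk u * ((a u / 2 ^ j : ℕ) : ℤ)
  have hgeven : (2 : ℤ) ∣ ∑ u : (ZMod ℓ)ˣ, g u := by
    refine two_dvd_sum_of_involution_invariant Finset.univ (fun u => -u) (fun u _ => Finset.mem_univ _)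
      (fun u _ => neg_neg u) (fun u _ => neg_ne_self_unit hℓ2 u) g fun u _ => ?_
    simp only [g, hkneg, ha_neg]
  obtain ⟨m, hm⟩ := hgeven
  -- the difference is `2^j ∑ g`
  have hdiff : levelSumTwo f ℓ (j + 1) ψ - levelSumTwo f ℓ j ψ' = 2 ^ j * ∑ u : (ZMod ℓ)ˣ, (g u : ℚ) := by
    unfold levelSumTwo
    rw [← Finset.sum_sub_distrib, Finset.mul_sum]
    refine Finset.sum_congr rfl fun u _ => ?_
    have hPq : ((2 ^ j : ℕ) : ℚ) = 2 ^ j := by norm_num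
    have hd : ((a u : ℕ) : ℚ) = ((a u % 2 ^ j : ℕ) : ℚ) + ((2 ^ j : ℕ) : ℚ) * ((a u / 2 ^ j : ℕ) : ℚ) := by
      exact_mod_cast (Nat.mod_add_div (a u) (2 ^ j)).symm
    have h2 : 2 * ratPlusSymbol f ((((u : ZMod ℓ).val : ℚ)) / ℓ) = kk u := by rw [hkk u]; ring
    have hψ'u : (((Multiplicative.toAdd (ψ' u)).val : ℕ) : ℚ) = ((a u % 2 ^ j : ℕ) : ℚ) := by
      exact_mod_cast hψ' u
    have hg' : ((g u : ℤ) : ℚ) = (kk u : ℚ) * ((a u / 2 ^ j : ℕ) : ℚ) := by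
      simp only [g, Int.cast_mul, Int.cast_natCast]
    show 2 * ratPlusSymbol f ((((u : ZMod ℓ).val : ℚ)) / ℓ) * ((a u : ℕ) : ℚ) -
        2 * ratPlusSymbol f ((((u : ZMod ℓ).val : ℚ)) / ℓ) * (((Multiplicative.toAdd (ψ' u)).val : ℕ) : ℚ) =
      2 ^ j * ((g u : ℤ) : ℚ)
    rw [hψ'u, h2, hg', hd, hPq]
    ring
  refine ⟨m, ?_, by rw [Rat.den_intCast]; exact odd_one⟩
  have hG : ((∑ u : (ZMod ℓ)ˣ, g u : ℤ) : ℚ) = ∑ u : (ZMod ℓ)ˣ, (g u : ℚ) := by push_cast; rfl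
  rw [hdiff, ← hG, hm]
  push_cast
  ring

/-- **LEVEL SHIFT, all rows (membership form).**  For the newform `f` of a globally minimal `W/ℚ` of positive analytic rank, an
odd prime `ℓ ∤ N_W` with `2^{j+1} ∣ ℓ − 1`, a SURJECTIVE `ψ : (ℤ/ℓ)ˣ → ℤ/2^{j+1}` with reduction `ψ'`, and every `m ≤ j + 1`:
`δ'_{j+1}(ℓ; ψ) ∈ 2^m ℤ_{(2)} ⟺ δ'_j(ℓ; ψ') ∈ 2^m ℤ_{(2)}` (top rows: equality, `…FklTopLevel`; non-top rows: the congruence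
above). [folklore] -/
theorem inTwoPowZLoc_levelSumTwo_succ_iff (W : WeierstrassCurve ℚ) [W.IsElliptic] [W.IsGloballyMinimal]
    {M : ℕ} [NeZero M] (f : CuspForm (Gamma0 M) 2) (hf : IsNewformOf W f) (hr : W.analyticRank ≠ 0)
    {ℓ : ℕ} [Fact ℓ.Prime] (hℓ2 : ℓ ≠ 2) (hN : ¬ ℓ ∣ W.conductorNorm ℤ) {j : ℕ} (h1 : 2 ^ (j + 1) ∣ ℓ - 1)
    (ψ : (ZMod ℓ)ˣ →* Multiplicative (ZMod (2 ^ (j + 1)))) (hψ : Function.Surjective ψ)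
    (ψ' : (ZMod ℓ)ˣ →* Multiplicative (ZMod (2 ^ j)))
    (hψ' : ∀ u, (Multiplicative.toAdd (ψ' u)).val = (Multiplicative.toAdd (ψ u)).val % 2 ^ j)
    {m : ℕ} (hm : m ≤ j + 1) :
    InTwoPowZLoc m (levelSumTwo f ℓ (j + 1) ψ) ↔ InTwoPowZLoc m (levelSumTwo f ℓ j ψ') := by
  have hℓ : ℓ.Prime := Fact.out
  have hcop : Nat.Coprime (W.conductorNorm ℤ) ℓ := ((Nat.Prime.coprime_iff_not_dvd hℓ).mpr hN).symm
  by_cases h2 : 2 ^ (j + 2) ∣ ℓ - 1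
  · exact inTwoPowZLoc_iff_of_sub hm (levelSumTwo_succ_sub_inTwoPowZLoc W f hf hr hℓ2 hN h2 ψ ψ' hψ')
  · rw [levelSumTwo_succ_eq_of_analyticRank_ne_zero W f hf hr hcop h1 h2 ψ hψ ψ' hψ']

/-! ## Level two is `T_ℓ mod 4` -/

/-- **Level two is the quadratic twist modulo `4`:** for the newform `f` of a globally minimal `W/ℚ` of positive analytic rank,
an odd prime `ℓ ∤ N_W` with `4 ∣ ℓ − 1` and ANY surjective `ψ : (ℤ/ℓ)ˣ → ℤ/4`:
`δ'_2(ℓ; ψ) ∈ 2^m ℤ_{(2)} ⟺ T_ℓ(f) ∈ 2^m ℤ_{(2)}` for `m ≤ 2` (level shift + g0's `δ'_1 = −T_ℓ`). [folklore] -/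
theorem inTwoPowZLoc_levelSumTwo_two_iff_twist (W : WeierstrassCurve ℚ) [W.IsElliptic] [W.IsGloballyMinimal]
    {M : ℕ} [NeZero M] (f : CuspForm (Gamma0 M) 2) (hf : IsNewformOf W f) (hr : W.analyticRank ≠ 0)
    {ℓ : ℕ} [Fact ℓ.Prime] (hN : ¬ ℓ ∣ W.conductorNorm ℤ) (h4 : 4 ∣ ℓ - 1)
    (ψ : (ZMod ℓ)ˣ →* Multiplicative (ZMod (2 ^ 2))) (hψ : Function.Surjective ψ) {m : ℕ} (hm : m ≤ 2) :
    InTwoPowZLoc m (levelSumTwo f ℓ 2 ψ) ↔ InTwoPowZLoc m (twistSymbolSum f ℓ) := by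
  have hℓ : ℓ.Prime := Fact.out
  have hℓ2 : ℓ ≠ 2 := by
    rintro rfl
    norm_num at h4
  have h1 : 2 ^ (1 + 1) ∣ ℓ - 1 := by norm_num; exact h4
  obtain ⟨ψ', hψ's, hψ'⟩ := exists_levelChar_reduction (j := 1) ψ hψ
  have key := inTwoPowZLoc_levelSumTwo_succ_iff W f hf hr hℓ2 hN (j := 1) h1 ψ hψ ψ' hψ' (m := m) (by omega)
  have h1' : levelSumTwo f ℓ 1 ψ' = - twistSymbolSum f ℓ := levelSumTwo_one_eq_neg_twistSymbolSum W f hf hr hℓ2 hN ψ' hψ's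
  rw [h1', inTwoPowZLoc_neg_iff] at key
  exact key

/-- **(HC) at level two, per row, in quadratic-twist currency.**  In the setting of the v7 stub `stub_firstLayerHigherCongruence`
restricted to a level-`2` row `(ℓ, 2, ψ)` (a `τ`-prime `ℓ ≡ 1 (mod 4)` with `4 ∣ a_ℓ − 2`, `ψ` onto `ℤ/4`) of a curve of positive
analytic rank: the required `δ'_2(ℓ; ψ) ∈ 2^{min(2, s+1)} ℤ_{(2)}` for `s ≥ 1` is EQUIVALENT to `T_ℓ(f) ∈ 4ℤ_{(2)}`
(«`Ш(E)[2] ≠ 0 ⇒ 4 ∣ L^{alg}(E^{(ℓ)}, 1)`»). [conjecture] reading, kernel theorem. -/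
theorem firstLayerHigherCongruence_levelTwo_iff (W : WeierstrassCurve ℚ) [W.IsElliptic] [W.IsGloballyMinimal]
    {M : ℕ} [NeZero M] (f : CuspForm (Gamma0 M) 2) (hf : IsNewformOf W f) (hr : W.analyticRank ≠ 0)
    {ℓ : ℕ} [Fact ℓ.Prime] (hlev : IsLevelAtTwo W ℓ) (h4 : (2 ^ 2 : ℤ) ∣ (ℓ : ℤ) - 1)
    (ψ : (ZMod ℓ)ˣ →* Multiplicative (ZMod (2 ^ 2))) (hψ : Function.Surjective ψ) {s : ℕ} (hs : 1 ≤ s) :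
    InTwoPowZLoc (min 2 (s + 1)) (levelSumTwo f ℓ 2 ψ) ↔ InTwoPowZLoc 2 (twistSymbolSum f ℓ) := by
  have hℓ : ℓ.Prime := Fact.out
  obtain ⟨-, hN⟩ := ne_two_and_not_dvd_of_isLevelAtTwo W hlev
  have h4' : 4 ∣ ℓ - 1 := by
    have h1 : 1 ≤ ℓ := hℓ.one_lt.le
    have : ((4 : ℕ) : ℤ) ∣ ((ℓ - 1 : ℕ) : ℤ) := by push_cast [Nat.cast_sub h1]; norm_num at h4; exact h4
    exact Int.natCast_dvd_natCast.mp this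
  rw [show min 2 (s + 1) = 2 by omega]
  exact inTwoPowZLoc_levelSumTwo_two_iff_twist W f hf hr hN h4' ψ hψ le_rfl

/-- **(NV) for parameter `0` from ANY `τ`-prime `ℓ ≡ 1 (mod 4)` with `4 ∣ a_ℓ − 2` and `T_ℓ(f) ≡ 2 (mod 4)`** (generalising
`…FklTopLevel.firstLayerNonVanishing_zero_of_twist`, which needed `ℓ ≡ 5 (mod 8)`): the row `(ℓ, 2, ψ)` has
`δ'_2(ℓ; ψ) ∉ 2^{0+2} ℤ_{(2)}`. [folklore] -/
theorem firstLayerNonVanishing_zero_of_twist' (W : WeierstrassCurve ℚ) [W.IsElliptic] [W.IsGloballyMinimal]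
    {M : ℕ} [NeZero M] (f : CuspForm (Gamma0 M) 2) (hf : IsNewformOf W f) (hr : W.analyticRank ≠ 0)
    (ℓ : ℕ) [Fact ℓ.Prime] (hlev : IsLevelAtTwo W ℓ) (h4 : 4 ∣ ℓ - 1)
    (ha : (2 ^ 2 : ℤ) ∣ W.frobeniusTrace ℓ - 2) (hT : ¬ InTwoPowZLoc 2 (twistSymbolSum f ℓ)) :
    ∃ (ℓ k : ℕ) (_ : Fact ℓ.Prime) (ψ : (ZMod ℓ)ˣ →* Multiplicative (ZMod (2 ^ k))),
      IsLevelAtTwo W ℓ ∧ 0 + 2 ≤ k ∧ (2 ^ k : ℤ) ∣ (ℓ : ℤ) - 1 ∧ (2 ^ k : ℤ) ∣ W.frobeniusTrace ℓ - 2 ∧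
      Function.Surjective ψ ∧ ¬ InTwoPowZLoc (0 + 2) (levelSumTwo f ℓ k ψ) := by
  have hℓ : ℓ.Prime := Fact.out
  obtain ⟨-, hN⟩ := ne_two_and_not_dvd_of_isLevelAtTwo W hlev
  have h4' : 2 ^ 2 ∣ ℓ - 1 := by norm_num; exact h4
  obtain ⟨ψ, hψ⟩ := exists_surjective_levelChar (ℓ := ℓ) h4'
  refine ⟨ℓ, 2, ‹Fact ℓ.Prime›, ψ, hlev, le_rfl, ?_, ha, hψ, ?_⟩
  · have h1 : 1 ≤ ℓ := hℓ.one_lt.le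
    have : ((2 ^ 2 : ℕ) : ℤ) ∣ ((ℓ - 1 : ℕ) : ℤ) := Int.natCast_dvd_natCast.mpr h4'
    push_cast [Nat.cast_sub h1] at this
    exact this
  · rw [zero_add, inTwoPowZLoc_levelSumTwo_two_iff_twist W f hf hr hN h4 ψ hψ le_rfl]
    exact hT

/-- **Clause (b) of K2-F for `Ш(E)[2^∞] = 0` curves from one prime quadratic twist, any `τ`-prime `ℓ ≡ 1 (mod 4)`** — under
the binders of the v7 stub `stub_firstLayerNonVanishing`: `#Ш(E)[2^∞] = 1` and some `τ`-prime `ℓ` with `4 ∣ ℓ − 1`,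
`4 ∣ a_ℓ − 2`, `T_ℓ(f) ∉ 4ℤ_{(2)}` give the stub's conclusion at `W`. [conjecture] instance, kernel theorem. -/
theorem stub_firstLayerNonVanishing_of_sha_trivial_of_twist'
    (W : WeierstrassCurve ℚ) [W.IsElliptic] [W.IsGloballyMinimal] {M : ℕ} [NeZero M]
    (f : CuspForm (Gamma0 M) 2) (hf : IsNewformOf W f) (_hper : PeriodTransferAtTwo W f)
    (_hsurj : ∀ n : ℕ, W.HasSurjectiveModNGaloisRep ((2 ^ n : ℕ) : ℤ)) (_hT : Odd W.torsionOrder)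
    (_hc : Odd W.tamagawaProduct) (hw : W.rootNumber = -1) (_hr : W.mordellWeilRank = 1)
    (_hfin : Finite (AddCommGroup.primaryComponent W.sha 2))
    (hsha : Nat.card (AddCommGroup.primaryComponent W.sha 2) = 1)
    (htw : ∃ (ℓ : ℕ) (_ : Fact ℓ.Prime), IsLevelAtTwo W ℓ ∧ 4 ∣ ℓ - 1 ∧ (2 ^ 2 : ℤ) ∣ W.frobeniusTrace ℓ - 2 ∧
      ¬ InTwoPowZLoc 2 (twistSymbolSum f ℓ)) :
    let s := padicValNat 2 (Nat.card (AddCommGroup.primaryComponent W.sha 2))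
    ∃ (ℓ k : ℕ) (_ : Fact ℓ.Prime) (ψ : (ZMod ℓ)ˣ →* Multiplicative (ZMod (2 ^ k))),
      IsLevelAtTwo W ℓ ∧ s + 2 ≤ k ∧ (2 ^ k : ℤ) ∣ (ℓ : ℤ) - 1 ∧ (2 ^ k : ℤ) ∣ W.frobeniusTrace ℓ - 2 ∧
      Function.Surjective ψ ∧ ¬ InTwoPowZLoc (s + 2) (levelSumTwo f ℓ k ψ) := by
  simp only [hsha, padicValNat_one_right]
  obtain ⟨ℓ, hℓ, hlev, h4, ha, hT⟩ := htw
  exact firstLayerNonVanishing_zero_of_twist' W f hf (W.analyticRank_pos_of_rootNumber_eq_neg_one hw).ne' ℓ hlev h4 ha hT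

/-- **The analytic twin:** clause (b) of K2-F_an for `ord₂ Ш_an ≤ 0` from one prime quadratic twist at any `τ`-prime
`ℓ ≡ 1 (mod 4)` — under the binders of `stub_analyticFirstLayerNonVanishing`. [conjecture] instance, kernel theorem. -/
theorem stub_analyticFirstLayerNonVanishing_of_padicValRat_le_of_twist'
    (W : WeierstrassCurve ℚ) [W.IsElliptic] [W.IsGloballyMinimal] {M : ℕ} [NeZero M]
    (f : CuspForm (Gamma0 M) 2) (hf : IsNewformOf W f) (_hper : PeriodTransferAtTwo W f)
    (_hsurj : ∀ n : ℕ, W.HasSurjectiveModNGaloisRep ((2 ^ n : ℕ) : ℤ)) (_hT : Odd W.torsionOrder)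
    (_hc : Odd W.tamagawaProduct) (_hw : W.rootNumber = -1) (han : W.analyticRank = 1)
    (q : ℚ) (_hq : shaAn W = (q : ℂ)) (_hq0 : q ≠ 0) (hv : padicValRat 2 q ≤ 0)
    (htw : ∃ (ℓ : ℕ) (_ : Fact ℓ.Prime), IsLevelAtTwo W ℓ ∧ 4 ∣ ℓ - 1 ∧ (2 ^ 2 : ℤ) ∣ W.frobeniusTrace ℓ - 2 ∧
      ¬ InTwoPowZLoc 2 (twistSymbolSum f ℓ)) :
    let s := (padicValRat 2 q).toNat
    ∃ (ℓ k : ℕ) (_ : Fact ℓ.Prime) (ψ : (ZMod ℓ)ˣ →* Multiplicative (ZMod (2 ^ k))),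
      IsLevelAtTwo W ℓ ∧ s + 2 ≤ k ∧ (2 ^ k : ℤ) ∣ (ℓ : ℤ) - 1 ∧ (2 ^ k : ℤ) ∣ W.frobeniusTrace ℓ - 2 ∧
      Function.Surjective ψ ∧ ¬ InTwoPowZLoc (s + 2) (levelSumTwo f ℓ k ψ) := by
  have hs : (padicValRat 2 q).toNat = 0 := Int.toNat_of_nonpos hv
  simp only [hs]
  obtain ⟨ℓ, hℓ, hlev, h4, ha, hT⟩ := htw
  exact firstLayerNonVanishing_zero_of_twist' W f hf (by rw [han]; exact one_ne_zero) ℓ hlev h4 ha hT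

end Summit.BirchSwinnertonDyer.BirchSwinnertonDyer.Theorems.RankOneAtTwoFkl

end
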